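import Summits.RiemannHypothesis.RiemannHypothesis.Theorems.SignConeSignConeOscillatoryExtremalNonnegMollifier
import Summits.RiemannHypothesis.RiemannHypothesis.Theorems.SignConeSignConeOscillatoryStubExtremalExistsValue

/-!
# Line `dual_witness` of crux `SignConeOscillatory` (stmt-RiemannHypothesis-16302): X₂ ⇔ crux, III — normalised mollifiers

For a NORMALISED windowed `u` (`∫|u|² = 1`, `supp u ⊆ [-a, a]`, finite archimedean energy) the mollifier sequence of part II is
rescaled to unit `L²` norm: tests `ṽₙ` with `tsupport ṽₙ ⊆ [-(a + a/(n+1)), a + a/(n+1)]`, `∫|ṽₙ|² = 1`, `∫|ṽₙ − u|² → 0` and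
archimedean energies `∫|(ṽₙ)^|² ρ → ∫|û|² ρ` (`exists_normalised_mollifier_seq`).  Consequently (the landed `L²` toolkit on the
window `2a`) node values, polar terms and the whole prime-free form converge: `reWar (ṽₙ ⋆ ṽ̃ₙ) → reWar (u ⋆ ũ)`
(`tendsto_reWar_normalised_mollifier`). [folklore]
-/

noncomputable section

-- `Summit.RiemannHypothesis.RiemannHypothesis.…` repeats a namespace component by design (D-0017 layout).
set_option linter.dupNamespace false

open scoped BigOperators ComplexConjugate Topology ENNReal
open MeasureTheory Set Filter Complex

namespace Summit.RiemannHypothesis.RiemannHypothesis.Theorems.SignCone.DualWitness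

open Literature.NumberTheory.LFunctions Literature.Analysis.SpecialFunctions

variable {a : ℝ} {u : ℝ → ℂ}

/-- Square roots of `L²` masses converge along `L²`-convergent sequences: `√∫|vₙ|² → √∫|u|²`. [folklore] -/
theorem tendsto_sqrt_integral_norm_sq {v : ℕ → ℝ → ℂ} (hv : ∀ n, MemLp (v n) 2 volume) (hu : MemLp u 2 volume)
    (hlim : Tendsto (fun n => ∫ x, ‖v n x - u x‖ ^ 2) atTop (𝓝 0)) :
    Tendsto (fun n => Real.sqrt (∫ x, ‖v n x‖ ^ 2)) atTop (𝓝 (Real.sqrt (∫ x, ‖u x‖ ^ 2))) := by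
  have hkey : ∀ n, |Real.sqrt (∫ x, ‖v n x‖ ^ 2) - Real.sqrt (∫ x, ‖u x‖ ^ 2)| ≤ Real.sqrt (∫ x, ‖v n x - u x‖ ^ 2) := by
    intro n
    have hB : Real.sqrt (∫ x, ‖v n x‖ ^ 2) ≤ Real.sqrt (∫ x, ‖v n x - u x‖ ^ 2) + Real.sqrt (∫ x, ‖u x‖ ^ 2) := by
      have := sqrt_integral_norm_sq_sub_le ((hv n).sub hu) hu.neg
      have e' : (fun x => ‖(v n - u) x - (-u) x‖ ^ 2) = fun x => ‖v n x‖ ^ 2 := by funext x; simp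
      rw [e'] at this; simpa [norm_neg] using this
    have hC : Real.sqrt (∫ x, ‖u x‖ ^ 2) ≤ Real.sqrt (∫ x, ‖u x - v n x‖ ^ 2) + Real.sqrt (∫ x, ‖v n x‖ ^ 2) := by
      have := sqrt_integral_norm_sq_sub_le (hu.sub (hv n)) (hv n).neg
      have e' : (fun x => ‖(u - v n) x - (-v n) x‖ ^ 2) = fun x => ‖u x‖ ^ 2 := by funext x; simp
      rw [e'] at this; simpa [norm_neg] using this
    have hsym : Real.sqrt (∫ x, ‖u x - v n x‖ ^ 2) = Real.sqrt (∫ x, ‖v n x - u x‖ ^ 2) := by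
      congr 1; refine integral_congr_ae (Eventually.of_forall fun x => ?_); simp [norm_sub_rev]
    rw [hsym] at hC
    rw [abs_le]; constructor <;> linarith
  have h0 : Tendsto (fun n => Real.sqrt (∫ x, ‖v n x - u x‖ ^ 2)) atTop (𝓝 0) := by
    have h := (Real.continuous_sqrt.tendsto 0).comp hlim
    rw [Real.sqrt_zero] at h; exact h
  rw [tendsto_iff_norm_sub_tendsto_zero]
  exact squeeze_zero (fun n => norm_nonneg _) (fun n => by rw [Real.norm_eq_abs]; exact hkey n) h0

/-- **Normalised mollifier sequence.**  For `u` windowed, `∫|u|² = 1`, of finite archimedean energy: tests `ṽₙ` with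
`tsupport ṽₙ ⊆ [-(a + a/(n+1)), a + a/(n+1)]`, `∫|ṽₙ|² = 1`, `∫|ṽₙ − u|² → 0`, `∫|(ṽₙ)^(1/2+it)|² ρ → ∫|û(1/2+it)|² ρ`.
[folklore] -/
theorem exists_normalised_mollifier_seq : ∀ {a : ℝ} {u : ℝ → ℂ}, 0 < a → MemLp u 2 volume → Function.support u ⊆ Icc (-a) a → (∫ x, ‖u x‖ ^ 2 = 1) → Integrable (fun t : ℝ => ‖weilMellin u (1 / 2 + t * I)‖ ^ 2 * reDigammaQuarter t) → ∃ v : ℕ → ℝ → ℂ, (∀ n, IsWeilTest (v n) ∧ tsupport (v n) ⊆ Icc (-(a + a / ((n : ℝ) + 1))) (a + a / ((n : ℝ) + 1)) ∧ ∫ x, ‖v n x‖ ^ 2 = 1) ∧ Tendsto (fun n => ∫ x, ‖v n x - u x‖ ^ 2) atTop (𝓝 0) ∧ Tendsto (fun n => ∫ t : ℝ, ‖weilMellin (v n) (1 / 2 + t * I)‖ ^ 2 * reDigammaQuarter t) atTop (𝓝 (∫ t : ℝ, ‖weilMellin u (1 / 2 + t * I)‖ ^ 2 * reDigammaQuarter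 t)) := by
  intro a u ha hu hsu hn1 hE
  obtain ⟨v, hv, hlim, hEn⟩ := exists_mollifier_seq ha hu hsu hE
  have hv2 : ∀ n, MemLp (v n) 2 volume := fun n => (hv n).1.1.continuous.memLp_of_hasCompactSupport (hv n).1.2
  -- masses `rₙ → 1`
  set r : ℕ → ℝ := fun n => ∫ x, ‖v n x‖ ^ 2 with hr
  have hsqrt : Tendsto (fun n => Real.sqrt (r n)) atTop (𝓝 1) := by
    have h := tendsto_sqrt_integral_norm_sq hv2 hu hlim
    rwa [hn1, Real.sqrt_one] at h
  have hrlim : Tendsto r atTop (𝓝 1) := by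
    have h := hsqrt.pow 2
    simp only [one_pow] at h
    refine h.congr fun n => Real.sq_sqrt (integral_nonneg fun _ => by positivity)
  -- a tail on which `rₙ > 1/4`; shift the sequence
  obtain ⟨n₀, hn₀⟩ := (Metric.tendsto_atTop.mp hrlim) (1 / 2) (by norm_num)
  have hrpos : ∀ n, 1 / 2 < r (n + n₀) := fun n => by
    have := hn₀ (n + n₀) (Nat.le_add_left _ _)
    rw [Real.dist_eq, abs_lt] at this; linarith [this.1]
  set c : ℕ → ℝ := fun n => (Real.sqrt (r (n + n₀)))⁻¹ with hc
  have hcpos : ∀ n, 0 < c n := fun n => inv_pos.mpr (Real.sqrt_pos.mpr (by linarith [hrpos n]))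
  have hc2 : ∀ n, c n ^ 2 = (r (n + n₀))⁻¹ := fun n => by
    rw [hc, inv_pow, Real.sq_sqrt (by linarith [hrpos n])]
  have hclim : Tendsto c atTop (𝓝 1) := by
    have h := (hsqrt.comp (tendsto_add_atTop_nat n₀)).inv₀ one_ne_zero
    rw [inv_one] at h; exact h
  refine ⟨fun n x => (c n : ℂ) * v (n + n₀) x, fun n => ⟨(hv (n + n₀)).1.const_mul _, ?_, ?_⟩, ?_, ?_⟩
  · refine (tsupport_mul_subset_right (f := fun _ : ℝ => (c n : ℂ)) (g := v (n + n₀))).trans ((hv (n + n₀)).2.trans ?_)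
    have h1 : a / (((n + n₀ : ℕ) : ℝ) + 1) ≤ a / ((n : ℝ) + 1) := by
      apply div_le_div_of_nonneg_left ha.le (by positivity); push_cast; linarith [(Nat.cast_nonneg n₀ : (0:ℝ) ≤ n₀)]
    exact Icc_subset_Icc (by linarith) (by linarith)
  · -- `∫ |c v|² = c² ∫|v|² = 1`
    have e : ∫ x, ‖(c n : ℂ) * v (n + n₀) x‖ ^ 2 = c n ^ 2 * ∫ x, ‖v (n + n₀) x‖ ^ 2 := by
      simp only [norm_mul, mul_pow, Complex.norm_real, Real.norm_eq_abs, sq_abs]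
      exact integral_const_mul _ _
    rw [e, hc2]
    exact inv_mul_cancel₀ (by linarith [hrpos n] : r (n + n₀) ≠ 0)
  · -- `L²` convergence: `c v − u = c (v − u) + (c − 1) u`, `|α + β|² ≤ 2|α|² + 2|β|²`
    have hlim' : Tendsto (fun n => ∫ x, ‖v (n + n₀) x - u x‖ ^ 2) atTop (𝓝 0) := hlim.comp (tendsto_add_atTop_nat n₀)
    have hu2i : Integrable (fun x => ‖u x‖ ^ 2) := (memLp_two_iff_integrable_sq_norm hu.1).mp hu
    have hbd : ∀ n, ∫ x, ‖(c n : ℂ) * v (n + n₀) x - u x‖ ^ 2 ≤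
        2 * c n ^ 2 * (∫ x, ‖v (n + n₀) x - u x‖ ^ 2) + 2 * (c n - 1) ^ 2 * (∫ x, ‖u x‖ ^ 2) := by
      intro n
      have hd2i : Integrable (fun x => ‖v (n + n₀) x - u x‖ ^ 2) :=
        (memLp_two_iff_integrable_sq_norm ((hv2 _).sub hu).1).mp ((hv2 _).sub hu)
      rw [← integral_const_mul, ← integral_const_mul, ← integral_add (hd2i.const_mul _) (hu2i.const_mul _)]
      refine integral_mono_of_nonneg (Eventually.of_forall fun x => by positivity) ((hd2i.const_mul _).add (hu2i.const_mul _))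
        (Eventually.of_forall fun x => ?_)
      beta_reduce
      have e : (c n : ℂ) * v (n + n₀) x - u x = (c n : ℂ) * (v (n + n₀) x - u x) + ((c n - 1 : ℝ) : ℂ) * u x := by
        push_cast; ring
      rw [e]
      have h1 := norm_add_le ((c n : ℂ) * (v (n + n₀) x - u x)) (((c n - 1 : ℝ) : ℂ) * u x)
      rw [norm_mul, norm_mul, Complex.norm_real, Complex.norm_real, Real.norm_eq_abs, Real.norm_eq_abs] at h1
      have hα : 0 ≤ |c n| * ‖v (n + n₀) x - u x‖ := by positivity
      have hβ : 0 ≤ |c n - 1| * ‖u x‖ := by positivity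
      calc ‖(c n : ℂ) * (v (n + n₀) x - u x) + ((c n - 1 : ℝ) : ℂ) * u x‖ ^ 2
          ≤ (|c n| * ‖v (n + n₀) x - u x‖ + |c n - 1| * ‖u x‖) ^ 2 := pow_le_pow_left₀ (norm_nonneg _) h1 2
        _ ≤ 2 * (|c n| * ‖v (n + n₀) x - u x‖) ^ 2 + 2 * (|c n - 1| * ‖u x‖) ^ 2 := by nlinarith [sq_nonneg (|c n| * ‖v (n + n₀) x - u x‖ - |c n - 1| * ‖u x‖)]
        _ = 2 * c n ^ 2 * ‖v (n + n₀) x - u x‖ ^ 2 + 2 * (c n - 1) ^ 2 * ‖u x‖ ^ 2 := by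
          rw [mul_pow, mul_pow, sq_abs, sq_abs]; ring
    have hup : Tendsto (fun n => 2 * c n ^ 2 * (∫ x, ‖v (n + n₀) x - u x‖ ^ 2) + 2 * (c n - 1) ^ 2 * (∫ x, ‖u x‖ ^ 2))
        atTop (𝓝 0) := by
      have h2 : Tendsto (fun n => c n - 1) atTop (𝓝 0) := by simpa using hclim.sub_const 1
      have := (((hclim.pow 2).const_mul 2).mul hlim').add (((h2.pow 2).const_mul 2).mul_const (∫ x, ‖u x‖ ^ 2))
      simpa using this
    exact squeeze_zero (fun n => integral_nonneg fun _ => by positivity) hbd hup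
  · -- energies: `|(c v)^|² = c² |v̂|²`
    have e : ∀ n, (∫ t : ℝ, ‖weilMellin (fun x => (c n : ℂ) * v (n + n₀) x) (1 / 2 + t * I)‖ ^ 2 * reDigammaQuarter t) =
        c n ^ 2 * ∫ t : ℝ, ‖weilMellin (v (n + n₀)) (1 / 2 + t * I)‖ ^ 2 * reDigammaQuarter t := by
      intro n
      rw [← integral_const_mul]
      refine integral_congr_ae (Eventually.of_forall fun t => ?_)
      beta_reduce
      rw [weilMellin_const_mul, norm_mul, mul_pow, Complex.norm_real, Real.norm_eq_abs, sq_abs]; ring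
    simp_rw [e]
    have h := (hclim.pow 2).mul (hEn.comp (tendsto_add_atTop_nat n₀))
    rw [one_pow, one_mul] at h
    exact h

end Summit.RiemannHypothesis.RiemannHypothesis.Theorems.SignCone.DualWitness

end
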